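import Literature.AnabelianGeometry.EtaleTheta.ThetaCohomology
import Literature.AnabelianGeometry.EtaleTheta.ContH1Injectivity

/-!
# [EtTh] Prop. 1.5 (iii): the uniqueness half, proved

Mochizuki, *The étale theta function …*, Publ. RIMS **45** (2009), Prop. 1.5 (iii), PRIMS PDF p. 23:
"Any class `η̈^Θ ∈ H¹(Π^tp_Ÿ, Δ_Θ)` arises from a UNIQUE class `η̈^Θ ∈ H¹((Π^tp_Ÿ)^Θ, Δ_Θ)` …"
[cite: MochizukiEtTh2009, Prop 1.5 (iii) p.23]. abc-iut-L2-t1 types the whole item as one predicate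
`ThetaSetting.Prop15iii E hC := ∀ x ∈ thetaClasses, ∃! x', infl x' = x ∧ …` (`ThetaCohomology.lean`);
the EXISTENCE and the `Z`-action formula constrain abstract data and stay hypotheses, but the
UNIQUENESS is a theorem of group cohomology: inflation `H¹((Π^tp_Ÿ)^Θ, Δ_Θ) → H¹(Π^tp_Ÿ, Δ_Θ)` along
the surjection `Π^tp_Ÿ ↠ (Π^tp_Ÿ)^Θ` is injective in degree one (abc-iut-L6-t23's
`ContH1.infl_injective_of_surjective`, `ContH1Injectivity.lean`). This file records it for t1's
objects (discharge companion by abc-iut-L2-t12; no statement of t1 is touched):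

* `ThetaSetting.inflTheta_injective` — `inflTheta H : H¹(H^Θ, Δ_Θ) → H¹(H, Δ_Θ)` is injective for
  every `H ≤ Π^tp_X`;
* `ThetaSetting.prop15iii_unique` — two classes of `H¹((Π^tp_Ÿ)^Θ, Δ_Θ)` inflating to the same class
  of `H¹(Π^tp_Ÿ, Δ_Θ)` are equal (so the `∃!` of `Prop15iii` reduces to `∃`).
-/

noncomputable section

namespace Literature.AnabelianGeometry.EtaleTheta

open Literature.AnabelianGeometry.SemiGraphs

namespace ThetaSetting

variable {p : ℕ} [Fact p.Prime] (D : ThetaSetting p)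

/-- **Inflation `H¹(H^Θ, Δ_Θ) → H¹(H, Δ_Θ)` is injective** for every `H ≤ Π^tp_X`, where
`H^Θ := ` the image of `H` in `(Π^tp_X)^Θ` (degree-one inflation along a surjection; "arises from a
unique class", Prop. 1.5 (iii)). [cite: MochizukiEtTh2009, Prop 1.5 (iii) p.23] -/
theorem inflTheta_injective (H : Subgroup D.PiTemp) : Function.Injective (D.inflTheta H) :=
  ContH1.infl_injective_of_surjective (A := D.DeltaTheta) (hψ := D.continuous_toTheta) le_rfl
    fun y => by
      obtain ⟨x, hx, hxy⟩ := Subgroup.mem_map.1 y.2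
      exact ⟨⟨x, hx⟩, hxy⟩

variable {D}

/-- **Prop. 1.5 (iii), uniqueness half — PROVED**: a class of `H¹(Π^tp_Ÿ, Δ_Θ)` arises from AT MOST
ONE class of `H¹((Π^tp_Ÿ)^Θ, Δ_Θ)`; in particular the `∃!` in `Prop15iii` is equivalent to `∃` with
the same two side conditions. [cite: MochizukiEtTh2009, Prop 1.5 (iii) p.23] -/
theorem prop15iii_unique {x : D.H1 D.GtpYdd} {x' x'' : D.H1Theta (D.GtpYdd.map D.toTheta)}
    (h' : D.inflTheta D.GtpYdd x' = x) (h'' : D.inflTheta D.GtpYdd x'' = x) : x' = x'' :=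
  D.inflTheta_injective D.GtpYdd (h'.trans h''.symm)

/-- Hence, for the `∃!` of `Prop15iii`: existence of a lift with the two printed properties already
gives unique existence. [cite: MochizukiEtTh2009, Prop 1.5 (iii) p.23] -/
theorem existsUnique_lift_of_exists {x : D.H1 D.GtpYdd}
    {P : D.H1Theta (D.GtpYdd.map D.toTheta) → Prop}
    (h : ∃ x' : D.H1Theta (D.GtpYdd.map D.toTheta), D.inflTheta D.GtpYdd x' = x ∧ P x') :
    ∃! x' : D.H1Theta (D.GtpYdd.map D.toTheta), D.inflTheta D.GtpYdd x' = x ∧ P x' := by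
  obtain ⟨x', hx', hP⟩ := h
  exact ⟨x', ⟨hx', hP⟩, fun y hy => prop15iii_unique hy.1 hx'⟩

end ThetaSetting

end Literature.AnabelianGeometry.EtaleTheta

end
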